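import Summits.Ventures.DiscreteObjects.Hadamard.SignedMultiplierTMatricesOdd
import Literature.Combinatorics.Designs.BaseSequences

/-!
# Hadamard 668 census — base sequences `BS(m, m, n, n)` with `m + n = 167` admit no reversal structure (kernel)

Framing: lottery ticket; floor = certified bounds/negative ranges.

Cell pub-namedobj (venture DiscreteObjects), target (H), hadamard gen 26 (HANDOFF-H-g25 item 4).  Base sequences
`(a; b; c; d) ∈ BS(m, m, n, n)` (lengths `m, m, n, n`, `±1`, `N_a + N_b + N_c + N_d = 0`) give T-sequences of length `m + n`
(`bsT`: `((a+b)/2, 0), ((a-b)/2, 0), (0, (c+d)/2), (0, (c-d)/2)`, BDKR 2013 §5) and hence `H(4(m+n))`; every split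
`m + n = 167` is a route to `H(668)` (`TurynTypeFamily668`).  The symmetries in print for such quadruples (BDKR 2013 §2:
negate / reverse single sequences, swap `a ↔ b`) suggest the structured sub-families in which the REVERSAL `x ↦ x'` acts on
each pair `{±a, ±b}`, `{±c, ±d}` as a signed permutation: every sequence reversal-symmetric or reversal-skew
(`a' = ±a, b' = ±b`), or the two sequences of a pair mutual reverses up to sign (`b = ±a'`), in any combination.  Here:
* `val_reflect_fst`, `val_reflect_snd` — the reflection `x ↦ (m - 1) - x` of `ZMod (m + n)` reverses the block `[0, m)` and the
  block `[m, m + n)` separately;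
* `halfPair_reversal` — if the reversal acts on `{±a, ±b}` as a signed permutation then it acts so on the half-sum / half-difference
  pair `{(a+b)/2, (a-b)/2}` (same-sign symmetric pairs and swapped pairs FIX the two half-rows, opposite-sign pairs SWAP them);
* `blockReversal_transfer` — so the periodised T-matrix rows of `bsT` carry a signed/permuted affine symmetry
  `t_{π k}((m - 1) - x) = ε_k t_k(x)`, which after translating by `(m - 1)/2` (`m + n` odd) is a signed/permuted multiplier `-1`;
* **`baseSeq_reversalClosed_odd_order`** — by the general census `negMultiplier_odd_order` (`SignedMultiplierTMatricesOdd`):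
  reversal-structured base sequences `BS(m, m, n, n)` with `m + n` odd, `> 1`, exist only if `m + n = 2s² + 1`;
* **`no_reversalClosed_baseSeq_167`** — `166 = 2s²` is impossible, so **for every split `m + n = 167` there are NO base sequences
  `BS(m, m, n, n)` on which the reversal acts pairwise as a signed permutation**; spelled-out cases:
  `no_symmetricSkew_baseSeq_167` (all four sequences reversal-symmetric or -skew, any signs), `no_mutualReverse_baseSeq_167`
  (`b = ±a'` and `d = ±c'`), `no_mixedReversal_baseSeq_167` (`a, b` symmetric/skew and `d = ±c'`).
(The length-`3` example `a = (1,1), b = (1,-1), c = d = (1)` of `BS(2,2,1,1)` is reversal-structured: `3 = 2·1² + 1`.)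
NEGATIVE lines about hypothetical objects (a structured sub-family of an open family is EMPTY); unstructured base sequences
with `m + n = 167` remain open and far beyond the search frontier (`BS(n+1,n)` known for `n ≤ 39` or so); no Hadamard order
excluded; H(668) untouched; HITS 0/4.  Ours, elementary given parts I–III and the odd-order census; no `sorry`; `decide` only on
`Equiv.Perm (Fin 2)`.
-/

open Finset BigOperators

namespace Summit.Ventures.DiscreteObjects.Hadamard

open Literature.Combinatorics.Designs.TSequences
open Literature.Combinatorics.Designs.TMatrices
open Literature.Combinatorics.Designs.BaseSequences

/-! ## §20 The reflection `x ↦ (m - 1) - x` of `ZMod (m + n)` reverses the two blocks -/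

section Blocks

variable {m n N : ℕ} [NeZero N]

/-- on the first block `[0, m)`: the reflection `x ↦ (m - 1) - x` is the reversal `v ↦ m - 1 - v`. -/
lemma val_reflect_fst (hN : m + n = N) {x : ZMod N} (hx : x.val < m) :
    (((m - 1 : ℕ) : ZMod N) - x).val = m - 1 - x.val := by
  have hcast : ((m - 1 : ℕ) : ZMod N) - x = ((m - 1 - x.val : ℕ) : ZMod N) := by
    rw [Nat.cast_sub (show x.val ≤ m - 1 by omega), ZMod.natCast_zmod_val]
  rw [hcast, ZMod.val_natCast, Nat.mod_eq_of_lt (by omega)]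

/-- on the second block `[m, m + n)`: the reflection `x ↦ (m - 1) - x` is the reversal `m + j ↦ m + (n - 1 - j)`, i.e.
`v ↦ N + m - 1 - v`. -/
lemma val_reflect_snd (hN : m + n = N) (hm : 0 < m) {x : ZMod N} (hx : m ≤ x.val) :
    (((m - 1 : ℕ) : ZMod N) - x).val = N + m - 1 - x.val := by
  have hv : x.val < N := ZMod.val_lt x
  have key : ((N + m - 1 - x.val : ℕ) : ZMod N) + ((x.val : ℕ) : ZMod N) = ((m - 1 : ℕ) : ZMod N) := by
    rw [← Nat.cast_add, show N + m - 1 - x.val + x.val = N + (m - 1) by omega, Nat.cast_add, ZMod.natCast_self, zero_add]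
  rw [ZMod.natCast_zmod_val] at key
  have hcast : ((m - 1 : ℕ) : ZMod N) - x = ((N + m - 1 - x.val : ℕ) : ZMod N) := by rw [← key]; ring
  rw [hcast, ZMod.val_natCast, Nat.mod_eq_of_lt (by omega)]

end Blocks

/-! ## §21 Transfer: block-wise reversal structure of T-sequences ⇒ signed/permuted reflection of the periodised rows -/

section Transfer

variable {m n N : ℕ} [NeZero N] {t : Fin 4 → ℕ → ℤ} {π : Equiv.Perm (Fin 4)} {ε : Fin 4 → ℤ}

/-- **transfer.**  Let `t` be four sequences of length `N = m + n` with rows `0, 1` supported on `[0, m)` and rows `2, 3` on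
`[m, N)`, and let `π` preserve the two pairs of rows.  If the reversal of the first block maps row `k ∈ {0,1}` to `ε_k · (row π k)`
and the reversal of the second block maps row `k ∈ {2,3}` to `ε_k · (row π k)`, then the periodised rows satisfy
`t_{π k}((m - 1) - x) = ε_k t_k(x)` on `ZMod N`. -/
theorem blockReversal_transfer (hN : m + n = N) (hm : 0 < m)
    (hz01 : ∀ k, (k = 0 ∨ k = 1) → ∀ i, m ≤ i → t k i = 0) (hz23 : ∀ k, (k = 2 ∨ k = 3) → ∀ i, i < m → t k i = 0)
    (hπ01 : ∀ k, (k = 0 ∨ k = 1) → (π k = 0 ∨ π k = 1)) (hπ23 : ∀ k, (k = 2 ∨ k = 3) → (π k = 2 ∨ π k = 3))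
    (hrev01 : ∀ k, (k = 0 ∨ k = 1) → ∀ i, i < m → t (π k) (m - 1 - i) = ε k * t k i)
    (hrev23 : ∀ k, (k = 2 ∨ k = 3) → ∀ j, j < n → t (π k) (m + (n - 1 - j)) = ε k * t k (m + j)) :
    ∀ k (x : ZMod N), periodize N (t (π k)) (((m - 1 : ℕ) : ZMod N) - x) = ε k * periodize N (t k) x := by
  intro k x
  have hk : (k = 0 ∨ k = 1) ∨ (k = 2 ∨ k = 3) := by
    fin_cases k
    · exact Or.inl (Or.inl rfl)
    · exact Or.inl (Or.inr rfl)
    · exact Or.inr (Or.inl rfl)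
    · exact Or.inr (Or.inr rfl)
  show t (π k) ((((m - 1 : ℕ) : ZMod N) - x).val) = ε k * t k x.val
  by_cases hx : x.val < m
  · rw [val_reflect_fst hN hx]
    rcases hk with hk | hk
    · exact hrev01 k hk x.val hx
    · rw [hz23 (π k) (hπ23 k hk) _ (by omega), hz23 k hk _ hx, mul_zero]
  · have hxm : m ≤ x.val := not_lt.mp hx
    have hv : x.val < N := ZMod.val_lt x
    rw [val_reflect_snd hN hm hxm]
    obtain ⟨j, hj, hjn⟩ : ∃ j, x.val = m + j ∧ j < n := ⟨x.val - m, by omega, by omega⟩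
    rcases hk with hk | hk
    · rw [hz01 (π k) (hπ01 k hk) _ (by omega), hz01 k hk _ hxm, mul_zero]
    · rw [hj, show N + m - 1 - (m + j) = m + (n - 1 - j) by omega]
      exact hrev23 k hk j hjn

omit [NeZero N] in
/-- `2` is invertible modulo an odd `N`: `2 · (N + 1)/2 = 1`. -/
lemma two_mul_half_succ (hodd : N % 2 = 1) : (2 : ZMod N) * (((N + 1) / 2 : ℕ) : ZMod N) = 1 := by
  rw [show (2 : ZMod N) = ((2 : ℕ) : ZMod N) by norm_cast, ← Nat.cast_mul,
    show 2 * ((N + 1) / 2) = N + 1 by omega, Nat.cast_add, ZMod.natCast_self, Nat.cast_one, zero_add]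

/-- **recentred transfer ⇒ the odd-order census applies**: under the hypotheses of `blockReversal_transfer`, if `t` are
T-sequences of odd length `N = m + n > 1` then `N = 2s² + 1` for an integer `s` (translate the periodised T-matrix rows by
`(m - 1)/2`, obtaining a signed/permuted multiplier `-1`; `negMultiplier_odd_order`). -/
theorem blockReversal_tSeq_odd_order (hN : m + n = N) (hodd : N % 2 = 1) (h1 : 1 < N) (hm : 0 < m) (ht : IsTSeq N t)
    (hz01 : ∀ k, (k = 0 ∨ k = 1) → ∀ i, m ≤ i → t k i = 0) (hz23 : ∀ k, (k = 2 ∨ k = 3) → ∀ i, i < m → t k i = 0)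
    (hπ01 : ∀ k, (k = 0 ∨ k = 1) → (π k = 0 ∨ π k = 1)) (hπ23 : ∀ k, (k = 2 ∨ k = 3) → (π k = 2 ∨ π k = 3))
    (hε : ∀ k, ε k = 1 ∨ ε k = -1)
    (hrev01 : ∀ k, (k = 0 ∨ k = 1) → ∀ i, i < m → t (π k) (m - 1 - i) = ε k * t k i)
    (hrev23 : ∀ k, (k = 2 ∨ k = 3) → ∀ j, j < n → t (π k) (m + (n - 1 - j)) = ε k * t k (m + j)) :
    ∃ s : ℤ, (N : ℤ) = 2 * s ^ 2 + 1 := by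
  have htr := blockReversal_transfer hN hm hz01 hz23 hπ01 hπ23 hrev01 hrev23
  set c : ZMod N := ((m - 1 : ℕ) : ZMod N) with hc
  set x₀ : ZMod N := (((N + 1) / 2 : ℕ) : ZMod N) * c with hx₀
  have h2 : x₀ + x₀ = c := by
    rw [hx₀, ← two_mul, ← mul_assoc, two_mul_half_succ hodd, one_mul]
  set u : Fin 4 → ZMod N → ℤ := fun k x => periodize N (t k) (x + x₀) with hu
  have hut : IsTMatrixRows N u := tmatrixRows_translate (tseq_tmatrixRows ht) x₀
  have hmul : ∀ k x, u (π k) (-x) = ε k * u k x := fun k x => by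
    show periodize N (t (π k)) (-x + x₀) = ε k * periodize N (t k) (x + x₀)
    have e : -x + x₀ = c - (x + x₀) := by linear_combination h2
    rw [e]
    exact htr k (x + x₀)
  exact negMultiplier_odd_order hodd h1 hut hε hmul

end Transfer

/-! ## §22 From a signed permutation on `{±a, ±b}` to one on `{(a+b)/2, (a-b)/2}` -/

section HalfPair

variable {m : ℕ} {a b : ℕ → ℤ}

/-- the two permutations of `Fin 2`. -/
private lemma perm_fin2_cases (σ : Equiv.Perm (Fin 2)) : σ = 1 ∨ σ = Equiv.swap 0 1 := by
  revert σ
  decide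

/-- pointwise: a common sign on `a, b` passes to the half-sum and half-difference. -/
private lemma half_same {u v u' v' e : ℤ} (hu : u = 1 ∨ u = -1) (hv : v = 1 ∨ v = -1) (he : e = 1 ∨ e = -1)
    (hu' : u' = e * u) (hv' : v' = e * v) :
    (if u' = v' then u' else 0) = e * (if u = v then u else 0) ∧
      (if u' = v' then 0 else u') = e * (if u = v then 0 else u) := by
  subst hu' hv'
  rcases hu with rfl | rfl <;> rcases hv with rfl | rfl <;> rcases he with rfl | rfl <;> norm_num

/-- pointwise: opposite signs on `a, b` swap the half-sum and the half-difference. -/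
private lemma half_opp {u v u' v' e : ℤ} (hu : u = 1 ∨ u = -1) (hv : v = 1 ∨ v = -1) (he : e = 1 ∨ e = -1)
    (hu' : u' = e * u) (hv' : v' = -(e * v)) :
    (if u' = v' then 0 else u') = e * (if u = v then u else 0) ∧
      (if u' = v' then u' else 0) = e * (if u = v then 0 else u) := by
  subst hu' hv'
  rcases hu with rfl | rfl <;> rcases hv with rfl | rfl <;> rcases he with rfl | rfl <;> norm_num

/-- pointwise: a swap `a' = e b, b' = e a` fixes the half-sum and negates the half-difference (up to `e`). -/
private lemma half_swap {u v u' v' e : ℤ} (hu : u = 1 ∨ u = -1) (hv : v = 1 ∨ v = -1) (he : e = 1 ∨ e = -1)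
    (hu' : u' = e * v) (hv' : v' = e * u) :
    (if u' = v' then u' else 0) = e * (if u = v then u else 0) ∧
      (if u' = v' then 0 else u') = -e * (if u = v then 0 else u) := by
  subst hu' hv'
  rcases hu with rfl | rfl <;> rcases hv with rfl | rfl <;> rcases he with rfl | rfl <;> norm_num

/-- **half-pair lemma.**  If the reversal of length `m` acts on `{±a, ±b}` as a signed permutation
(`(a,b)_{σ j}(m-1-i) = e_j (a,b)_j(i)`), then it acts as a signed permutation on `{(a+b)/2, (a-b)/2}` (division-free
`hsum`, `hdiff`). -/
theorem halfPair_reversal (ha : PMOn m a) (hb : PMOn m b) {σ : Equiv.Perm (Fin 2)} {e : Fin 2 → ℤ}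
    (he : ∀ j, e j = 1 ∨ e j = -1) (hrev : ∀ j, ∀ i, i < m → (![a, b] (σ j)) (m - 1 - i) = e j * (![a, b] j) i) :
    ∃ (σ' : Equiv.Perm (Fin 2)) (e' : Fin 2 → ℤ), (∀ j, e' j = 1 ∨ e' j = -1) ∧
      ∀ j, ∀ i, i < m → (![hsum a b, hdiff a b] (σ' j)) (m - 1 - i) = e' j * (![hsum a b, hdiff a b] j) i := by
  rcases perm_fin2_cases σ with rfl | rfl
  · -- `a' = e₀ a`, `b' = e₁ b`
    have ra : ∀ i, i < m → a (m - 1 - i) = e 0 * a i := fun i hi => by simpa using hrev 0 i hi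
    have rb : ∀ i, i < m → b (m - 1 - i) = e 1 * b i := fun i hi => by simpa using hrev 1 i hi
    by_cases hs : e 1 = e 0
    · refine ⟨1, fun _ => e 0, fun _ => he 0, fun j i hi => ?_⟩
      have h := half_same (ha i hi) (hb i hi) (he 0) (ra i hi) (show b (m - 1 - i) = e 0 * b i by rw [rb i hi, hs])
      fin_cases j
      · simpa [hsum] using h.1
      · simpa [hdiff] using h.2
    · have hs' : e 1 = -e 0 := by
        rcases he 0 with h0 | h0 <;> rcases he 1 with h1 | h1 <;> simp_all
      refine ⟨Equiv.swap 0 1, fun _ => e 0, fun _ => he 0, fun j i hi => ?_⟩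
      have h := half_opp (ha i hi) (hb i hi) (he 0) (ra i hi)
        (show b (m - 1 - i) = -(e 0 * b i) by rw [rb i hi, hs', neg_mul])
      fin_cases j
      · simpa [hsum, hdiff] using h.1
      · simpa [hsum, hdiff] using h.2
  · -- `b' = e₀ a`, `a' = e₁ b`; for `m > 0` necessarily `e₁ = e₀`, but we only need the two relations
    have rb : ∀ i, i < m → b (m - 1 - i) = e 0 * a i := fun i hi => by simpa using hrev 0 i hi
    have ra : ∀ i, i < m → a (m - 1 - i) = e 1 * b i := fun i hi => by simpa using hrev 1 i hi
    -- `a' = e₁ b` and `b' = e₀ a`: at position `i`, with `i' = m-1-i`, also `a i = e₁ b i'`… we use the pair (ra, rb) at `i`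
    have hee : ∀ i, i < m → e 1 = e 0 := fun i hi => by
      have h1 := ra (m - 1 - i) (by omega)
      rw [show m - 1 - (m - 1 - i) = i by omega, rb i hi] at h1
      -- `a i = e 1 * (e 0 * a i)`
      rcases ha i hi with h | h <;> rcases he 0 with h0 | h0 <;> rcases he 1 with h1' | h1' <;>
        simp_all
    refine ⟨1, ![e 0, -e 0], fun j => ?_, fun j i hi => ?_⟩
    · fin_cases j
      · simpa using he 0
      · rcases he 0 with h | h <;> simp [h]
    · have h := half_swap (ha i hi) (hb i hi) (he 0) (show a (m - 1 - i) = e 0 * b i by rw [ra i hi, hee i hi]) (rb i hi)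
      fin_cases j
      · simpa [hsum] using h.1
      · simpa [hdiff] using h.2

end HalfPair

/-! ## §23 Assembling the two blocks and the theorems for base sequences -/

section BaseSeq

variable {m n : ℕ} {a b c d : ℕ → ℤ}

/-- assembling two signed permutations of `Fin 2` (one per block) into a block-preserving signed permutation of the four
T-rows of `bsT`, with the block-wise reversal relations. -/
lemma bsT_blockReversal {σ τ : Equiv.Perm (Fin 2)} {e f : Fin 2 → ℤ} (he : ∀ j, e j = 1 ∨ e j = -1)
    (hf : ∀ j, f j = 1 ∨ f j = -1)
    (hAB : ∀ j, ∀ i, i < m → (![hsum a b, hdiff a b] (σ j)) (m - 1 - i) = e j * (![hsum a b, hdiff a b] j) i)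
    (hCD : ∀ j, ∀ i, i < n → (![hsum c d, hdiff c d] (τ j)) (n - 1 - i) = f j * (![hsum c d, hdiff c d] j) i) :
    ∃ (π : Equiv.Perm (Fin 4)) (ε : Fin 4 → ℤ), (∀ k, ε k = 1 ∨ ε k = -1) ∧
      (∀ k, (k = 0 ∨ k = 1) → (π k = 0 ∨ π k = 1)) ∧ (∀ k, (k = 2 ∨ k = 3) → (π k = 2 ∨ π k = 3)) ∧
      (∀ k, (k = 0 ∨ k = 1) → ∀ i, i < m → bsT m a b c d (π k) (m - 1 - i) = ε k * bsT m a b c d k i) ∧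
      (∀ k, (k = 2 ∨ k = 3) → ∀ j, j < n → bsT m a b c d (π k) (m + (n - 1 - j)) = ε k * bsT m a b c d k (m + j)) := by
  have hε : ∀ k, (![e 0, e 1, f 0, f 1] : Fin 4 → ℤ) k = 1 ∨ (![e 0, e 1, f 0, f 1] : Fin 4 → ℤ) k = -1 := by
    intro k
    fin_cases k
    · simpa using he 0
    · simpa using he 1
    · simpa using hf 0
    · simpa using hf 1
  -- the block-wise relations for the rows of `bsT`, read off `hAB` / `hCD`
  have hA0 : ∀ i, i < m → (![hsum a b, hdiff a b] (σ 0)) (m - 1 - i) = e 0 * hsum a b i := fun i hi => hAB 0 i hi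
  have hA1 : ∀ i, i < m → (![hsum a b, hdiff a b] (σ 1)) (m - 1 - i) = e 1 * hdiff a b i := fun i hi => hAB 1 i hi
  have hC0 : ∀ i, i < n → (![hsum c d, hdiff c d] (τ 0)) (n - 1 - i) = f 0 * hsum c d i := fun i hi => hCD 0 i hi
  have hC1 : ∀ i, i < n → (![hsum c d, hdiff c d] (τ 1)) (n - 1 - i) = f 1 * hdiff c d i := fun i hi => hCD 1 i hi
  rcases perm_fin2_cases σ with rfl | rfl <;> rcases perm_fin2_cases τ with rfl | rfl
  · refine ⟨1, ![e 0, e 1, f 0, f 1], hε, fun k hk => by simpa using hk, fun k hk => by simpa using hk, ?_, ?_⟩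
    · rintro k (rfl | rfl) i hi
      · simpa [bsT, cat, hi, show m - 1 - i < m by omega] using hA0 i hi
      · simpa [bsT, cat, hi, show m - 1 - i < m by omega] using hA1 i hi
    · rintro k (rfl | rfl) j hj
      · simpa [bsT, cat] using hC0 j hj
      · simpa [bsT, cat] using hC1 j hj
  · refine ⟨Equiv.swap 2 3, ![e 0, e 1, f 0, f 1], hε, ?_, ?_, ?_, ?_⟩
    · rintro k (rfl | rfl) <;> decide
    · rintro k (rfl | rfl) <;> decide
    · rintro k (rfl | rfl) i hi
      · simpa [bsT, cat, hi, show m - 1 - i < m by omega, Equiv.swap_apply_of_ne_of_ne] using hA0 i hi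
      · simpa [bsT, cat, hi, show m - 1 - i < m by omega, Equiv.swap_apply_of_ne_of_ne] using hA1 i hi
    · rintro k (rfl | rfl) j hj
      · simpa [bsT, cat, Equiv.swap_apply_left] using hC0 j hj
      · simpa [bsT, cat, Equiv.swap_apply_right] using hC1 j hj
  · refine ⟨Equiv.swap 0 1, ![e 0, e 1, f 0, f 1], hε, ?_, ?_, ?_, ?_⟩
    · rintro k (rfl | rfl) <;> decide
    · rintro k (rfl | rfl) <;> decide
    · rintro k (rfl | rfl) i hi
      · simpa [bsT, cat, hi, show m - 1 - i < m by omega, Equiv.swap_apply_left] using hA0 i hi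
      · simpa [bsT, cat, hi, show m - 1 - i < m by omega, Equiv.swap_apply_right] using hA1 i hi
    · rintro k (rfl | rfl) j hj
      · simpa [bsT, cat, Equiv.swap_apply_of_ne_of_ne] using hC0 j hj
      · simpa [bsT, cat, Equiv.swap_apply_of_ne_of_ne] using hC1 j hj
  · refine ⟨Equiv.swap 0 1 * Equiv.swap 2 3, ![e 0, e 1, f 0, f 1], hε, ?_, ?_, ?_, ?_⟩
    · rintro k (rfl | rfl) <;> decide
    · rintro k (rfl | rfl) <;> decide
    · rintro k (rfl | rfl) i hi
      · simpa [bsT, cat, hi, show m - 1 - i < m by omega, Equiv.Perm.mul_apply, Equiv.swap_apply_left,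
          Equiv.swap_apply_of_ne_of_ne] using hA0 i hi
      · simpa [bsT, cat, hi, show m - 1 - i < m by omega, Equiv.Perm.mul_apply, Equiv.swap_apply_right,
          Equiv.swap_apply_of_ne_of_ne] using hA1 i hi
    · rintro k (rfl | rfl) j hj
      · simpa [bsT, cat, Equiv.Perm.mul_apply, Equiv.swap_apply_left, Equiv.swap_apply_of_ne_of_ne] using hC0 j hj
      · simpa [bsT, cat, Equiv.Perm.mul_apply, Equiv.swap_apply_right, Equiv.swap_apply_of_ne_of_ne] using hC1 j hj

/-- **reversal-structured base sequences of odd total length force `m + n = 2s² + 1`.**  If `(a; b; c; d) ∈ BS(m, m, n, n)`,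
`m + n` odd and `> 1`, `m > 0`, and the reversal acts on `{±a, ±b}` (length `m`) and on `{±c, ±d}` (length `n`) as signed
permutations, then `m + n = 2s² + 1` for an integer `s`. -/
theorem baseSeq_reversalClosed_odd_order (h : IsBaseSeq m n a b c d) (hodd : (m + n) % 2 = 1) (h1 : 1 < m + n)
    (hm : 0 < m) {σ τ : Equiv.Perm (Fin 2)} {e f : Fin 2 → ℤ} (he : ∀ j, e j = 1 ∨ e j = -1)
    (hf : ∀ j, f j = 1 ∨ f j = -1) (hAB : ∀ j, ∀ i, i < m → (![a, b] (σ j)) (m - 1 - i) = e j * (![a, b] j) i)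
    (hCD : ∀ j, ∀ i, i < n → (![c, d] (τ j)) (n - 1 - i) = f j * (![c, d] j) i) :
    ∃ s : ℤ, ((m + n : ℕ) : ℤ) = 2 * s ^ 2 + 1 := by
  haveI : NeZero (m + n) := ⟨by omega⟩
  obtain ⟨σ', e', he', hAB'⟩ := halfPair_reversal h.1 h.2.1 he hAB
  obtain ⟨τ', f', hf', hCD'⟩ := halfPair_reversal h.2.2.1 h.2.2.2.1 hf hCD
  obtain ⟨π, ε, hε, hπ01, hπ23, hrev01, hrev23⟩ := bsT_blockReversal he' hf' hAB' hCD'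
  refine blockReversal_tSeq_odd_order (t := bsT m a b c d) rfl hodd h1 hm (baseSeq_tseq h) ?_ ?_ hπ01 hπ23 hε hrev01 hrev23
  · rintro k (rfl | rfl) i hi <;> simp [bsT, cat, not_lt.mpr hi]
  · rintro k (rfl | rfl) i hi <;> simp [bsT, cat, hi]

/-- `166 = 2 s²` has no integer solution (`83` is not a square). -/
lemma not_167_eq_two_sq_add_one (s : ℤ) : (167 : ℤ) ≠ 2 * s ^ 2 + 1 := by
  intro h
  have h83 : s ^ 2 = 83 := by linarith
  have hs : s ≤ 9 := by nlinarith
  have hs' : -9 ≤ s := by nlinarith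
  interval_cases s <;> omega

/-- **No reversal-structured base sequences with `m + n = 167`.**  For every split `m + n = 167` (`m > 0`) there are no base
sequences `(a; b; c; d) ∈ BS(m, m, n, n)` on which the reversal acts on `{±a, ±b}` and on `{±c, ±d}` as signed permutations
(`(a,b)_{σ j}' = e_j (a,b)_j`, `(c,d)_{τ j}' = f_j (c,d)_j`).  Unstructured base sequences remain OPEN. -/
theorem no_reversalClosed_baseSeq_167 (hmn : m + n = 167) (hm : 0 < m) (h : IsBaseSeq m n a b c d)
    {σ τ : Equiv.Perm (Fin 2)} {e f : Fin 2 → ℤ} (he : ∀ j, e j = 1 ∨ e j = -1) (hf : ∀ j, f j = 1 ∨ f j = -1)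
    (hAB : ∀ j, ∀ i, i < m → (![a, b] (σ j)) (m - 1 - i) = e j * (![a, b] j) i)
    (hCD : ∀ j, ∀ i, i < n → (![c, d] (τ j)) (n - 1 - i) = f j * (![c, d] j) i) : False := by
  obtain ⟨s, hs⟩ := baseSeq_reversalClosed_odd_order h (by omega) (by omega) hm he hf hAB hCD
  rw [hmn] at hs
  exact not_167_eq_two_sq_add_one s (by exact_mod_cast hs)

/-- **case (i): all four sequences reversal-symmetric or reversal-skew** (`a' = αa, b' = βb, c' = γc, d' = δd`, any signs):
impossible for base sequences `BS(m, m, n, n)` with `m + n = 167`. -/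
theorem no_symmetricSkew_baseSeq_167 (hmn : m + n = 167) (hm : 0 < m) (h : IsBaseSeq m n a b c d) {α β γ δ : ℤ}
    (hα : α = 1 ∨ α = -1) (hβ : β = 1 ∨ β = -1) (hγ : γ = 1 ∨ γ = -1) (hδ : δ = 1 ∨ δ = -1)
    (ha : ∀ i, i < m → a (m - 1 - i) = α * a i) (hb : ∀ i, i < m → b (m - 1 - i) = β * b i)
    (hc : ∀ i, i < n → c (n - 1 - i) = γ * c i) (hd : ∀ i, i < n → d (n - 1 - i) = δ * d i) : False := by
  refine no_reversalClosed_baseSeq_167 hmn hm h (σ := 1) (τ := 1) (e := ![α, β]) (f := ![γ, δ]) ?_ ?_ ?_ ?_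
  · intro j; fin_cases j <;> simpa using by first | exact hα | exact hβ
  · intro j; fin_cases j <;> simpa using by first | exact hγ | exact hδ
  · intro j i hi; fin_cases j
    · simpa using ha i hi
    · simpa using hb i hi
  · intro j i hi; fin_cases j
    · simpa using hc i hi
    · simpa using hd i hi

/-- **case (ii): the sequences of each pair are mutual reverses up to sign** (`b = αa'`, `d = γc'`): impossible for base
sequences `BS(m, m, n, n)` with `m + n = 167`. -/
theorem no_mutualReverse_baseSeq_167 (hmn : m + n = 167) (hm : 0 < m) (h : IsBaseSeq m n a b c d) {α γ : ℤ}
    (hα : α = 1 ∨ α = -1) (hγ : γ = 1 ∨ γ = -1) (hb : ∀ i, i < m → b (m - 1 - i) = α * a i)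
    (hd : ∀ i, i < n → d (n - 1 - i) = γ * c i) : False := by
  have ha : ∀ i, i < m → a (m - 1 - i) = α * b i := fun i hi => by
    have e := hb (m - 1 - i) (by omega)
    rw [show m - 1 - (m - 1 - i) = i by omega] at e
    rw [e]; rcases hα with r | r <;> simp [r]
  have hc : ∀ i, i < n → c (n - 1 - i) = γ * d i := fun i hi => by
    have e := hd (n - 1 - i) (by omega)
    rw [show n - 1 - (n - 1 - i) = i by omega] at e
    rw [e]; rcases hγ with r | r <;> simp [r]
  refine no_reversalClosed_baseSeq_167 hmn hm h (σ := Equiv.swap 0 1) (τ := Equiv.swap 0 1) (e := fun _ => α)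
    (f := fun _ => γ) (fun _ => hα) (fun _ => hγ) ?_ ?_
  · intro j i hi; fin_cases j
    · simpa using hb i hi
    · simpa using ha i hi
  · intro j i hi; fin_cases j
    · simpa using hd i hi
    · simpa using hc i hi

/-- **case (iii), mixed: `a, b` reversal-symmetric/skew and `d = γc'`**: impossible for base sequences `BS(m, m, n, n)` with
`m + n = 167`.  (The remaining mixed case, `b = αa'` with `c, d` symmetric/skew, is `no_reversalClosed_baseSeq_167` with
`σ = swap`, `τ = 1`.) -/
theorem no_mixedReversal_baseSeq_167 (hmn : m + n = 167) (hm : 0 < m) (h : IsBaseSeq m n a b c d) {α β γ : ℤ}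
    (hα : α = 1 ∨ α = -1) (hβ : β = 1 ∨ β = -1) (hγ : γ = 1 ∨ γ = -1)
    (ha : ∀ i, i < m → a (m - 1 - i) = α * a i) (hb : ∀ i, i < m → b (m - 1 - i) = β * b i)
    (hd : ∀ i, i < n → d (n - 1 - i) = γ * c i) : False := by
  have hc : ∀ i, i < n → c (n - 1 - i) = γ * d i := fun i hi => by
    have e := hd (n - 1 - i) (by omega)
    rw [show n - 1 - (n - 1 - i) = i by omega] at e
    rw [e]; rcases hγ with r | r <;> simp [r]
  refine no_reversalClosed_baseSeq_167 hmn hm h (σ := 1) (τ := Equiv.swap 0 1) (e := ![α, β]) (f := fun _ => γ) ?_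
    (fun _ => hγ) ?_ ?_
  · intro j; fin_cases j <;> simpa using by first | exact hα | exact hβ
  · intro j i hi; fin_cases j
    · simpa using ha i hi
    · simpa using hb i hi
  · intro j i hi; fin_cases j
    · simpa using hd i hi
    · simpa using hc i hi

end BaseSeq

end Summit.Ventures.DiscreteObjects.Hadamard
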